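import Mathlib
import HarnessLib
import Summits.CriticalPhenomena.PercolationContinuityZ3.Theses.PercTreeValue
import Summits.CriticalPhenomena.PercolationContinuityZ3.Theorems.PercTreeValueTetrahedronHarrisGapStubCondHarris
import Summits.CriticalPhenomena.PercolationContinuityZ3.Theorems.PercTreeValueTetrahedronHarrisGapStubG
import Literature.Probability.Percolation.BlockResampling
import Literature.Probability.Percolation.InfiniteClusterDensity
import Literature.Probability.Percolation.TwoPointFunction
import Literature.Probability.Percolation.PercolationProofs

/-!
# Crux `TetrahedronHarrisGap` (stmt-CriticalPhenomena-7799), line `SketchIdeator1` rev 5: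
# influence variance ∧ coherence ⟹ crux, and blocking ⟹ influence variance

Line `SketchIdeator1` (card `corner-ball-total-covariance`; skeleton `Cruxes/TetrahedronHarrisGap/Lines/SketchIdeator1.lean`,
rev 5, lead prover-line-stmt-CriticalPhenomena-7799-c1-0).  Companion of `…CoherenceReduction.lean` (`crux_of_block_of_coherence`):
the composition is split at its natural joint, the INFLUENCE VARIANCE of the corner-ball bulk.  With `f_r = P(0 ↔ a_r | ω off K_r)`,
`g_r = P(b_r ↔ c_r | ω off K_r)` (`blockCondProb`; `K_r` = the lattice edges touching the four corner boxes of sup-radius `r/8`):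

* `crux_of_varLower_of_coherence` : `(∃ c_V > 0, ∀ r ≥ r₀, c_V τ(0,a_r)² ≤ Var f_r) → (∃ c > 0, ∀ r ≥ r₀, c Var f_r ≤ Cov(f_r, g_r)) →
  TetrahedronHarrisGap` (`δ = c · c_V`) — ideator 2's `MirrorAssembly` (`InfluenceVariance → MirrorCoherence → crux`) for THIS window,
  over the tree's finite-block conditional probabilities; no blocking hypothesis;
* `varLower_of_block` : blocking `P(f_r = 0) ≥ c_B` implies the influence-variance bound with `c_V = c_B`
  (on `{f_r = 0}` the deviation `(f_r − τ)²` is `τ²`) — so for the corner-ball window `InfluenceVariance` is a corollary of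
  `PercAnnulusCrossing.CritAnnulusNonCrossing` (stmt-0846) via `stub_block_of_critAnnulusNonCrossing`;
(The two combined give back the landed `crux_of_block_of_coherence` of `…CoherenceReduction.lean`.)

Proof of the first: `P(A ∩ B) ≥ ∫ f g` (conditional Harris inside the corner block, `stub_condHarris`), `∫ f = τ_A`, `∫ g = τ_B`
(tower `integral_blockCondProb_eq`), coherence, the variance hypothesis, and `τ_B = τ_A` (`tau_opposite_edge_eq`).
No new definitions; sorry-free; all ℤ³-inputs are HYPOTHESES (reductions, not a proof of the crux).
-/

noncomputable section

open MeasureTheory Filter Set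
open Literature.Probability.Percolation Literature.Probability.LatticeModels

namespace Summit.CriticalPhenomena.PercolationContinuityZ3.Theorems.TetrahedronHarrisGap

/-- **crux_of_varLower_of_coherence** (registered sub-goal of stmt-CriticalPhenomena-7799). An influence-variance lower bound
`c_V τ(0,a_r)² ≤ Var f_r` and coherence `c · Var f_r ≤ Cov(f_r, g_r)` imply the crux `TetrahedronHarrisGap`, with `δ = c · c_V`:
`P(A ∩ B) ≥ ∫ f g ≥ τ_A τ_B + c Var f ≥ τ_A τ_B + c c_V τ_A² = (1 + c c_V) τ_A τ_B`.  Hypotheses `let`-bind `K`, `f`, `g`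
(definitionally the registered stub texts of the skeleton). -/
theorem crux_of_varLower_of_coherence :
    (∃ c_V : ℝ, 0 < c_V ∧ ∃ r₀ : ℕ, ∀ r : ℕ, r₀ ≤ r →
      let K : Finset (Sym2 (Site 3)) :=
        armEdges (r / 8) (0 : Site 3) ∪ armEdges (r / 8) ![(r : ℤ), (r : ℤ), 0] ∪
          armEdges (r / 8) ![(r : ℤ), 0, (r : ℤ)] ∪ armEdges (r / 8) ![0, (r : ℤ), (r : ℤ)];
      let f : BondConfig (Site 3) → ℝ :=
        blockCondProb (zdGraph 3) (criticalProbI 3) K (openConn (0 : Site 3) ![(r : ℤ), (r : ℤ), 0]);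
      c_V * tau 3 (criticalProbI 3) 0 ![(r : ℤ), (r : ℤ), 0] ^ 2 ≤
        ∫ ω, f ω ^ 2 ∂(bondPercolation (zdGraph 3) (criticalProbI 3)) -
          (∫ ω, f ω ∂(bondPercolation (zdGraph 3) (criticalProbI 3))) ^ 2) →
    (∃ c : ℝ, 0 < c ∧ ∃ r₀ : ℕ, ∀ r : ℕ, r₀ ≤ r →
      let K : Finset (Sym2 (Site 3)) :=
        armEdges (r / 8) (0 : Site 3) ∪ armEdges (r / 8) ![(r : ℤ), (r : ℤ), 0] ∪
          armEdges (r / 8) ![(r : ℤ), 0, (r : ℤ)] ∪ armEdges (r / 8) ![0, (r : ℤ), (r : ℤ)];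
      let f : BondConfig (Site 3) → ℝ :=
        blockCondProb (zdGraph 3) (criticalProbI 3) K (openConn (0 : Site 3) ![(r : ℤ), (r : ℤ), 0]);
      let g : BondConfig (Site 3) → ℝ :=
        blockCondProb (zdGraph 3) (criticalProbI 3) K (openConn ![(r : ℤ), 0, (r : ℤ)] ![0, (r : ℤ), (r : ℤ)]);
      c * (∫ ω, f ω ^ 2 ∂(bondPercolation (zdGraph 3) (criticalProbI 3)) -
            (∫ ω, f ω ∂(bondPercolation (zdGraph 3) (criticalProbI 3))) ^ 2) ≤
        ∫ ω, f ω * g ω ∂(bondPercolation (zdGraph 3) (criticalProbI 3)) -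
          (∫ ω, f ω ∂(bondPercolation (zdGraph 3) (criticalProbI 3))) *
            (∫ ω, g ω ∂(bondPercolation (zdGraph 3) (criticalProbI 3)))) →
    Summit.CriticalPhenomena.PercolationContinuityZ3.Theses.PercTreeValue.TetrahedronHarrisGap := by
  intro hV hCoh
  classical
  obtain ⟨cV, hcV, r₁, hV⟩ := hV
  obtain ⟨c, hc, r₂, hCoh⟩ := hCoh
  unfold Summit.CriticalPhenomena.PercolationContinuityZ3.Theses.PercTreeValue.TetrahedronHarrisGap
  refine ⟨c * cV, by positivity, max r₁ r₂, fun r hr => ?_⟩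
  have hr₁ : r₁ ≤ r := le_trans (le_max_left _ _) hr
  have hr₂ : r₂ ≤ r := le_trans (le_max_right _ _) hr
  have hV' := hV r hr₁
  have hCoh' := hCoh r hr₂
  dsimp only at hV' hCoh'
  clear hV hCoh
  -- names
  set P : Measure (BondConfig (Site 3)) := bondPercolation (zdGraph 3) (criticalProbI 3) with hP
  set K : Finset (Sym2 (Site 3)) :=
    armEdges (r / 8) (0 : Site 3) ∪ armEdges (r / 8) ![(r : ℤ), (r : ℤ), 0] ∪
      armEdges (r / 8) ![(r : ℤ), 0, (r : ℤ)] ∪ armEdges (r / 8) ![0, (r : ℤ), (r : ℤ)] with hK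
  set A : Set (BondConfig (Site 3)) := openConn (0 : Site 3) ![(r : ℤ), (r : ℤ), 0] with hA
  set B : Set (BondConfig (Site 3)) := openConn ![(r : ℤ), 0, (r : ℤ)] ![0, (r : ℤ), (r : ℤ)] with hB
  set f : BondConfig (Site 3) → ℝ := blockCondProb (zdGraph 3) (criticalProbI 3) K A with hf
  set g : BondConfig (Site 3) → ℝ := blockCondProb (zdGraph 3) (criticalProbI 3) K B with hg
  have hAm : MeasurableSet A := measurableSet_openConn_holds _ _
  have hBm : MeasurableSet B := measurableSet_openConn_holds _ _
  have hAu : IsUpperSet A := isUpperSet_openConn _ _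
  have hBu : IsUpperSet B := isUpperSet_openConn _ _
  -- the two-point functions are the means of `f`, `g`, and they coincide
  have hτA : tau 3 (criticalProbI 3) 0 ![(r : ℤ), (r : ℤ), 0] = ∫ ω, f ω ∂P := by
    rw [tau_def, hf, integral_blockCondProb_eq _ _ K hAm]
  have hτB : tau 3 (criticalProbI 3) ![(r : ℤ), 0, (r : ℤ)] ![0, (r : ℤ), (r : ℤ)] = ∫ ω, g ω ∂P := by
    rw [tau_def, hg, integral_blockCondProb_eq _ _ K hBm]
  have hτBA : tau 3 (criticalProbI 3) ![(r : ℤ), 0, (r : ℤ)] ![0, (r : ℤ), (r : ℤ)] =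
      tau 3 (criticalProbI 3) 0 ![(r : ℤ), (r : ℤ), 0] := tau_opposite_edge_eq _ r
  set τ : ℝ := tau 3 (criticalProbI 3) 0 ![(r : ℤ), (r : ℤ), 0] with hτ
  -- conditional Harris: `∫ f g ≤ P(A ∩ B)`
  have hcond := stub_condHarris (criticalProbI 3) K A B hAu hBu hAm hBm
  -- the hypotheses, rewritten with `τ`
  have hV'' : cV * τ ^ 2 ≤ ∫ ω, f ω ^ 2 ∂P - τ ^ 2 := by
    have h := hV'
    rw [← hτA] at h
    exact h
  have hCoh'' : c * (∫ ω, f ω ^ 2 ∂P - τ ^ 2) ≤ ∫ ω, f ω * g ω ∂P - τ * τ := by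
    have h := hCoh'
    rw [← hτA, ← hτB, hτBA] at h
    exact h
  -- assemble
  have hmain : (1 + c * cV) * τ * τ ≤ P.real (A ∩ B) := by
    have h1 : c * (cV * τ ^ 2) ≤ c * (∫ ω, f ω ^ 2 ∂P - τ ^ 2) := mul_le_mul_of_nonneg_left hV'' hc.le
    nlinarith [hcond, hCoh'', h1]
  rw [hτBA]
  exact hmain

/-- **varLower_of_block** (registered sub-goal of stmt-CriticalPhenomena-7799). Blocking implies the influence-variance lower bound
for the corner-ball bulk, with `c_V = c_B`: `Var f_r = ∫ (f_r − τ)² ≥ τ² · P(f_r = 0) ≥ c_B τ²` (`τ = τ(0,a_r) = ∫ f_r`).  Hence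
ideator 2's `InfluenceVariance` for this window is a corollary of `PercAnnulusCrossing.CritAnnulusNonCrossing` (stmt-0846) via
`stub_block_of_critAnnulusNonCrossing`. -/
theorem varLower_of_block :
    (∃ c_B : ℝ, 0 < c_B ∧ ∃ r₀ : ℕ, ∀ r : ℕ, r₀ ≤ r →
      let K : Finset (Sym2 (Site 3)) :=
        armEdges (r / 8) (0 : Site 3) ∪ armEdges (r / 8) ![(r : ℤ), (r : ℤ), 0] ∪
          armEdges (r / 8) ![(r : ℤ), 0, (r : ℤ)] ∪ armEdges (r / 8) ![0, (r : ℤ), (r : ℤ)];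
      let f : BondConfig (Site 3) → ℝ :=
        blockCondProb (zdGraph 3) (criticalProbI 3) K (openConn (0 : Site 3) ![(r : ℤ), (r : ℤ), 0]);
      let g : BondConfig (Site 3) → ℝ :=
        blockCondProb (zdGraph 3) (criticalProbI 3) K (openConn ![(r : ℤ), 0, (r : ℤ)] ![0, (r : ℤ), (r : ℤ)]);
      c_B ≤ (bondPercolation (zdGraph 3) (criticalProbI 3)).real {ω | f ω = 0} ∧
        c_B ≤ (bondPercolation (zdGraph 3) (criticalProbI 3)).real {ω | g ω = 0}) →
    (∃ c_V : ℝ, 0 < c_V ∧ ∃ r₀ : ℕ, ∀ r : ℕ, r₀ ≤ r →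
      let K : Finset (Sym2 (Site 3)) :=
        armEdges (r / 8) (0 : Site 3) ∪ armEdges (r / 8) ![(r : ℤ), (r : ℤ), 0] ∪
          armEdges (r / 8) ![(r : ℤ), 0, (r : ℤ)] ∪ armEdges (r / 8) ![0, (r : ℤ), (r : ℤ)];
      let f : BondConfig (Site 3) → ℝ :=
        blockCondProb (zdGraph 3) (criticalProbI 3) K (openConn (0 : Site 3) ![(r : ℤ), (r : ℤ), 0]);
      c_V * tau 3 (criticalProbI 3) 0 ![(r : ℤ), (r : ℤ), 0] ^ 2 ≤
        ∫ ω, f ω ^ 2 ∂(bondPercolation (zdGraph 3) (criticalProbI 3)) -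
          (∫ ω, f ω ∂(bondPercolation (zdGraph 3) (criticalProbI 3))) ^ 2) := by
  intro hBl
  classical
  obtain ⟨cB, hcB, r₁, hBl⟩ := hBl
  refine ⟨cB, hcB, r₁, fun r hr => ?_⟩
  have hBl' := hBl r hr
  dsimp only at hBl' ⊢
  clear hBl
  set P : Measure (BondConfig (Site 3)) := bondPercolation (zdGraph 3) (criticalProbI 3) with hP
  set K : Finset (Sym2 (Site 3)) :=
    armEdges (r / 8) (0 : Site 3) ∪ armEdges (r / 8) ![(r : ℤ), (r : ℤ), 0] ∪
      armEdges (r / 8) ![(r : ℤ), 0, (r : ℤ)] ∪ armEdges (r / 8) ![0, (r : ℤ), (r : ℤ)] with hK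
  set A : Set (BondConfig (Site 3)) := openConn (0 : Site 3) ![(r : ℤ), (r : ℤ), 0] with hA
  set f : BondConfig (Site 3) → ℝ := blockCondProb (zdGraph 3) (criticalProbI 3) K A with hf
  have hAm : MeasurableSet A := measurableSet_openConn_holds _ _
  have hfm : Measurable f := measurable_blockCondProb _ _ K hAm
  have hf0 : ∀ ω, 0 ≤ f ω := fun ω => blockCondProb_nonneg _ _ K A ω
  have hf1 : ∀ ω, f ω ≤ 1 := fun ω => blockCondProb_le_one _ _ K A ω
  have hfi : Integrable f P := by
    simpa [hP] using (integrable_blockCondProb (zdGraph 3) (criticalProbI 3) K hAm)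
  have hf2i : Integrable (fun ω => f ω ^ 2) P := by
    refine Integrable.of_bound (hfm.pow_const 2).aestronglyMeasurable 1 (ae_of_all _ fun ω => ?_)
    rw [Real.norm_eq_abs, abs_of_nonneg (sq_nonneg _)]
    nlinarith [hf0 ω, hf1 ω]
  have hτA : tau 3 (criticalProbI 3) 0 ![(r : ℤ), (r : ℤ), 0] = ∫ ω, f ω ∂P := by
    rw [tau_def, hf, integral_blockCondProb_eq _ _ K hAm]
  set τ : ℝ := tau 3 (criticalProbI 3) 0 ![(r : ℤ), (r : ℤ), 0] with hτ
  rw [← hτA]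
  have hmeas0 : MeasurableSet {ω | f ω = 0} := hfm (measurableSet_singleton 0)
  -- pointwise: `(f - τ)² ≥ τ² · 1{f = 0}`
  have hpt : ∀ ω, τ ^ 2 * {ω | f ω = 0}.indicator (fun _ => (1 : ℝ)) ω ≤ (f ω - τ) ^ 2 := by
    intro ω
    by_cases h : f ω = 0
    · rw [Set.indicator_of_mem (show ω ∈ {ω | f ω = 0} from h), mul_one, h]
      ring_nf
      exact le_refl _
    · rw [Set.indicator_of_notMem (show ω ∉ {ω | f ω = 0} from h), mul_zero]
      exact sq_nonneg _
  have hind : Integrable (fun ω => {ω | f ω = 0}.indicator (fun _ => (1 : ℝ)) ω) P :=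
    (integrable_const (1 : ℝ)).indicator hmeas0
  have hlin : Integrable (fun ω => 2 * τ * f ω) P := hfi.const_mul (2 * τ)
  have hquad : Integrable (fun ω => f ω ^ 2 - 2 * τ * f ω) P := hf2i.sub hlin
  have hsqi : Integrable (fun ω => (f ω - τ) ^ 2) P := by
    have : (fun ω => (f ω - τ) ^ 2) = fun ω => f ω ^ 2 - 2 * τ * f ω + τ ^ 2 := by
      funext ω; ring
    rw [this]
    exact hquad.add (integrable_const _)
  have h1 : τ ^ 2 * P.real {ω | f ω = 0} ≤ ∫ ω, (f ω - τ) ^ 2 ∂P := by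
    calc τ ^ 2 * P.real {ω | f ω = 0}
        = ∫ ω, τ ^ 2 * {ω | f ω = 0}.indicator (fun _ => (1 : ℝ)) ω ∂P := by
          rw [integral_const_mul, integral_indicator_const _ hmeas0, smul_eq_mul, mul_one]
      _ ≤ ∫ ω, (f ω - τ) ^ 2 ∂P := integral_mono (hind.const_mul _) hsqi hpt
  have h2 : ∫ ω, (f ω - τ) ^ 2 ∂P = ∫ ω, f ω ^ 2 ∂P - τ ^ 2 := by
    have : (fun ω => (f ω - τ) ^ 2) = fun ω => f ω ^ 2 - 2 * τ * f ω + τ ^ 2 := by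
      funext ω; ring
    rw [this, integral_add hquad (integrable_const _), integral_sub hf2i hlin, integral_const_mul,
      integral_const, probReal_univ, one_smul, ← hτA]
    ring
  have h3 : cB * τ ^ 2 ≤ τ ^ 2 * P.real {ω | f ω = 0} := by
    rw [mul_comm]
    exact mul_le_mul_of_nonneg_left hBl'.1 (sq_nonneg _)
  linarith

end Summit.CriticalPhenomena.PercolationContinuityZ3.Theorems.TetrahedronHarrisGap

end
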